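import Summits.AtomisticToContinuum.Crystallization.Theorems.FrustratedLawDichotomyStrainedPatchHomExteriorLeafV2
import Summits.AtomisticToContinuum.Crystallization.Theorems.FrustratedLawDichotomyStrainedPatchHomExteriorColumn

/-!
# Strained patch, `(H)` hcp certificate (architecture R3) — the v2 exterior slab as a semantic leaf and the FIVE-KIND column menu `colLeaf5`
# (listed cell | kernel `entryLeafOKHC` | `exteriorOK` v1 | `annulusOK` | ★ `exteriorOK2`), closed by ONE `decide` (decomp-a2c hand 2, generation 39; structural #18)

`semOKH_of_exteriorOK2` (p854134's soundness packaged), the menu `colLeaf5 L μ₀` with leaf labels `ℕ ⊕ Unit ⊕ ExtLeafData ⊕ AnnLeafData ⊕ ExtLeafData` (the last summand read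
by `exteriorOK2`), and ★ `semOKH_root_of_colManifest5` — the root consumer hand-1 g40's generator targets after NOTE l.7506.  0 sorry; standard axioms.
`--supports stmt-AtomisticToContinuum-27623`.  [formal bookkeeping]
-/

namespace Summit.AtomisticToContinuum.Crystallization.Theorems.FrustratedLawDichotomyStrainedPatchHomExteriorRay

open Summit.AtomisticToContinuum.Crystallization.Theorems.FrustratedLawDichotomyStrainedPatchHomEntryGramHcp (rootCH rootWH)
open Summit.AtomisticToContinuum.Crystallization.Theorems.FrustratedLawDichotomyStrainedPatchHomEntryLeafHT (semOKH semOKH_of_sound semOKH_anti_box)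
open Summit.AtomisticToContinuum.Crystallization.Theorems.FrustratedLawDichotomyStrainedPatchHomForceCentredHcp (entryLeafOKHC)
open Summit.AtomisticToContinuum.Crystallization.Theorems.FrustratedLawDichotomyStrainedPatchHomCutTree (CutTree cutOK coveredAt coveredAt_sound
  semOKH_of_cutOK_leaves semOKH_of_entryLeafOKHC_level)

/-- ★ **An accepted v2 exterior slab is a semantic fact at every level.** [formal bookkeeping] -/
theorem semOKH_of_exteriorOK2 {J : Fin 3 → Fin 3 × Fin 3 → ℤ} {cC wC cH wH : Bx} {ch : List (Bx × Bx × (Fin 3 → Fin 3 → ℤ) × ℤ)} {lmin g : ℤ} {i : Fin 3}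
    {c w : Bx} (h : exteriorOK2 J cC wC cH wH ch lmin g i c w = true) (μ : ℤ) : semOKH μ c w = true :=
  semOKH_of_sound (μ := μ) (fun c w => exteriorOK2 J cC wC cH wH ch lmin g i c w)
    (fun _ _ hv U ξ hsa hU hbox hξ h0 h2 => exteriorOK2_sound hv U ξ hsa hU hbox hξ h0 h2) h

/-- **THE FIVE-KIND COLUMN LEAF MENU**: `inl i` listed cell; `inr (inl ())` kernel `entryLeafOKHC μ₀`; `inr (inr (inl e))` `exteriorOK` (v1); `inr (inr (inr (inl a)))`
`annulusOK`; `inr (inr (inr (inr e)))` ★ `exteriorOK2` (v2: PSD floors, gap from the reference range).  Computable. -/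
def colLeaf5 (L : List (Bx × Bx)) (μ₀ : ℤ) : ℕ ⊕ (Unit ⊕ (ExtLeafData ⊕ (AnnLeafData ⊕ ExtLeafData))) → Bx → Bx → Bool
  | .inl i, c, w => coveredAt L i c w
  | .inr (.inl _), c, w => entryLeafOKHC μ₀ c w
  | .inr (.inr (.inl e)), c, w => exteriorOK e.J e.cC e.wC e.cH e.wH e.ch e.lmin e.g e.i c w
  | .inr (.inr (.inr (.inl a))), c, w => annulusOK a.J a.cC a.wC a.cH a.wH a.ch a.ll a.den a.na a.nb a.g a.i c w
  | .inr (.inr (.inr (.inr e))), c, w => exteriorOK2 e.J e.cC e.wC e.cH e.wH e.ch e.lmin e.g e.i c w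

/-- ★★ **THE FIVE-KIND MENU FOLD.** [formal bookkeeping] -/
theorem semOKH_of_cutOK_colLeaf5 {μ μ₀ : ℤ} (hle : μ ≤ μ₀) (L : List (Bx × Bx)) (hL : ∀ b ∈ L, semOKH μ b.1 b.2 = true) :
    ∀ (t : CutTree ((Fin 3 × Fin 3) ⊕ Fin 3) (ℕ ⊕ (Unit ⊕ (ExtLeafData ⊕ (AnnLeafData ⊕ ExtLeafData))))) (c w : Bx),
      cutOK (colLeaf5 L μ₀) t c w = true → semOKH μ c w = true :=
  semOKH_of_cutOK_leaves (colLeaf5 L μ₀) fun a c w h => by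
    rcases a with i | u | e | a | e
    · exact coveredAt_sound (semOKH μ) (fun _ _ _ _ hc h => semOKH_anti_box hc h) L hL i c w h
    · exact semOKH_of_entryLeafOKHC_level hle h
    · exact semOKH_of_exteriorOK h μ
    · exact semOKH_of_annulusOK h μ
    · exact semOKH_of_exteriorOK2 h μ

/-- ★★★ **THE hcp ROOT FACT FROM A FIVE-KIND COLUMN MANIFEST.** [formal bookkeeping] -/
theorem semOKH_root_of_colManifest5 {μ μ₀ : ℤ} (hle : μ ≤ μ₀) (L : List (Bx × Bx)) (hL : ∀ b ∈ L, semOKH μ b.1 b.2 = true)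
    (t : CutTree ((Fin 3 × Fin 3) ⊕ Fin 3) (ℕ ⊕ (Unit ⊕ (ExtLeafData ⊕ (AnnLeafData ⊕ ExtLeafData)))))
    (h : cutOK (colLeaf5 L μ₀) t rootCH rootWH = true) : semOKH μ rootCH rootWH = true :=
  semOKH_of_cutOK_colLeaf5 hle L hL t rootCH rootWH h

end Summit.AtomisticToContinuum.Crystallization.Theorems.FrustratedLawDichotomyStrainedPatchHomExteriorRay
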